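import Summits.NavierStokesRegularity.FunctionalMining.PlanarShadowRates
import Summits.NavierStokesRegularity.FunctionalMining.PlanarShadowTopEig
import HarnessLib

/-!
# FunctionalMining — PLANAR SHADOW for the eigenvalue cores (part 6): the rows `ES.lam1.q=4`,
# `ES.neglam3.q=4 | T_C | C3a, C3b` are FALSE for every constant

Search for candidate a priori estimates; no regularity claim. Cell `pub-nsfunc`, prove seat
(gen 18). Refutations of CANDIDATE a priori inequalities; nothing about regularity.

For the planar witness `w` (`PlanarShadowWitness`): along EVERY classical solution `u` of
Navier–Stokes issued from `w` (any `ν ≥ 0`), the strain `S(u s)` has planar trace-free initial slice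
AND planar trace-free initial time derivative (strain transport identity
`StrainTensor.timeDerivWithin_strainFlat_eq` at `t = 0`: every term has vanishing middle row — the
tables `D 1 (·)` of the `x₁`-independent witness collect to `[]`). By the planar tangent lemma
(`PlanarShadowTopEig`) the eigenvalue moments `∫(λ₁⁺)⁴ = ∫λ(S)⁴` and `∫((−λ₃)⁺)⁴ = ∫λ(−S)⁴` therefore
have at `t = 0` the one-sided derivative `¼ d/dt∫|S|⁴ = ¼(N₄(w) + νV₄(w))`, with
`N₄(w) = (2/5)(2π)⁵ > 0` (`PlanarShadowRates`). The datum-local C3a/C3b doors then refute, for every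
`C`, the K0 rows

| K0 row | typed statement refuted here |
|---|---|
| `ES.lam1.q=4 \| T_C \| C3b / C3a` | `TopEigMomentMidEigRateBound 4 C` / `TopEigMomentStretchRateBound 4 C` |
| `ES.neglam3.q=4 \| T_C \| C3b / C3a` | `NegBotEigMomentMidEigRateBound 4 C` / `NegBotEigMomentStretchRateBound 4 C` |

(verdicts of record: DEAD ∀C by the numerical witness `−P2Db`, nogo `sievek/verdicts*.json`).
-/

noncomputable section

open MeasureTheory Set Filter Topology

namespace Summit.NavierStokesRegularity.FunctionalMining

open Literature.Analysis Literature.Analysis.FunctionSpaces Literature.Analysis.FunctionSpaces.Torus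
  Literature.Analysis.FluidPDE
open TopEig StrainL4 StrainTensor

variable {d : Type*} [Fintype d] [DecidableEq d]

/-! ## 1. The four rows as named statements -/

/-- K0 row **`ES.lam1.q|T_C|C3b`**: `d/dt∫(λ₁⁺)^q ≤ C‖λ₂⁺‖_∞∫(λ₁⁺)^q`. Search for candidate a priori
estimates; no regularity claim — nothing is asserted. [ours; typed K0 row] -/
@[conjecture] def TopEigMomentMidEigRateBound (q C : ℝ) : Prop :=
  FunctionalMidEigRateBound (d := d) (torusTopEigMoment q) C

/-- K0 row **`ES.lam1.q|T_C|C3a`**: `d/dt∫(λ₁⁺)^q ≤ C‖α⁺‖_∞∫(λ₁⁺)^q`. [ours; typed K0 row] -/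
@[conjecture] def TopEigMomentStretchRateBound (q C : ℝ) : Prop :=
  FunctionalStretchRateBound (d := d) (torusTopEigMoment q) C

/-- K0 row **`ES.neglam3.q|T_C|C3b`**: `d/dt∫((−λ₃)⁺)^q ≤ C‖λ₂⁺‖_∞∫((−λ₃)⁺)^q`. [ours; typed K0 row] -/
@[conjecture] def NegBotEigMomentMidEigRateBound (q C : ℝ) : Prop :=
  FunctionalMidEigRateBound (d := d) (torusNegBotEigMoment q) C

/-- K0 row **`ES.neglam3.q|T_C|C3a`**: `d/dt∫((−λ₃)⁺)^q ≤ C‖α⁺‖_∞∫((−λ₃)⁺)^q`. [ours; typed K0 row] -/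
@[conjecture] def NegBotEigMomentStretchRateBound (q C : ℝ) : Prop :=
  FunctionalStretchRateBound (d := d) (torusNegBotEigMoment q) C

/-! ## 2. Datum-local doors (a derivative value at ONE datum suffices) -/

/-- **C3b door, datum-local form.** If the C3b row holds for `Φ` and, at a smooth divergence-free
zero-mean datum `u₀` with `λ₂(S(u₀)) ≤ 0` pointwise, `s ↦ Φ(u s)` has the one-sided derivative
`N + νV` at the initial time along every classical solution issued from `u₀` (`ν > 0`), then `N ≤ 0`.
[ours] -/
theorem FunctionalMidEigRateBound.initialRateAt_nonpos
    {Φ : (UnitAddTorus d → EuclideanSpace ℝ d) → ℝ} {C : ℝ}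
    (hB : FunctionalMidEigRateBound Φ C) (hd : Fintype.card d = 3)
    {u₀ : UnitAddTorus d → EuclideanSpace ℝ d} (hu₀ : Torus.IsSmooth u₀) (hdiv : Torus.IsDivFree u₀)
    (hmean : Torus.HasZeroMean u₀)
    (hΛ : ∀ x, ∀ hx : (Matrix.of fun i j =>
        (Torus.partialDeriv j u₀ x i + Torus.partialDeriv i u₀ x j) / 2).IsHermitian,
        hx.eigenvalues₀ (Fin.cast hd.symm 1) ≤ 0)
    {N V : ℝ}
    (hrate : ∀ {ν : ℝ}, 0 < ν → ∀ {T : ℝ}, 0 < T →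
      ∀ {u : ℝ → UnitAddTorus d → EuclideanSpace ℝ d} {p : ℝ → UnitAddTorus d → ℝ},
        Torus.IsClassicalNSSolutionOn (Icc 0 T) ν 0 u p → u 0 = u₀ →
        (∀ t ∈ Icc 0 T, Torus.HasZeroMean (u t)) →
        HasDerivWithinAt (fun s => Φ (u s)) (N + ν * V) (Icc 0 T) 0) :
    N ≤ 0 := by
  refine inertialRate_nonpos_of_forall (V := V) fun ν hν => ?_
  obtain ⟨T, hT, v, p, hsol, hv0, -⟩ :=
    Torus.exists_classicalNS_smooth (d := d) hd.le hν.le hu₀ hdiv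
  have hmean' : ∀ t ∈ Icc 0 T, Torus.HasZeroMean (v t) := fun t ht =>
    hsol.hasZeroMean_of_hasZeroMean (convex_Icc 0 T) (left_mem_Icc.2 hT.le) ht (hv0 ▸ hmean)
  have h0 : (0 : ℝ) ∈ Icc 0 T := left_mem_Icc.2 hT.le
  have hder := hrate hν hT hsol hv0 hmean'
  have hΛ' : ∀ x, ∀ hx : (Matrix.of fun i j =>
      (Torus.partialDeriv j (v 0) x i + Torus.partialDeriv i (v 0) x j) / 2).IsHermitian,
      hx.eigenvalues₀ (Fin.cast hd.symm 1) ≤ 0 := by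
    rw [hv0]; exact hΛ
  have hle := hB hd hν.le hT hsol 0 h0 0 le_rfl hΛ' _ hder
  simpa using hle

/-- **C3a door, datum-local form** (`σ(u₀) ≤ 0` pointwise). [ours] -/
theorem FunctionalStretchRateBound.initialRateAt_nonpos
    {Φ : (UnitAddTorus d → EuclideanSpace ℝ d) → ℝ} {C : ℝ}
    (hB : FunctionalStretchRateBound Φ C) (hd : Fintype.card d = 3)
    {u₀ : UnitAddTorus d → EuclideanSpace ℝ d} (hu₀ : Torus.IsSmooth u₀) (hdiv : Torus.IsDivFree u₀)
    (hmean : Torus.HasZeroMean u₀) (hσ : ∀ x, torusStretchingDensity u₀ x ≤ 0) {N V : ℝ}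
    (hrate : ∀ {ν : ℝ}, 0 < ν → ∀ {T : ℝ}, 0 < T →
      ∀ {u : ℝ → UnitAddTorus d → EuclideanSpace ℝ d} {p : ℝ → UnitAddTorus d → ℝ},
        Torus.IsClassicalNSSolutionOn (Icc 0 T) ν 0 u p → u 0 = u₀ →
        (∀ t ∈ Icc 0 T, Torus.HasZeroMean (u t)) →
        HasDerivWithinAt (fun s => Φ (u s)) (N + ν * V) (Icc 0 T) 0) :
    N ≤ 0 := by
  refine inertialRate_nonpos_of_forall (V := V) fun ν hν => ?_
  obtain ⟨T, hT, v, p, hsol, hv0, -⟩ :=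
    Torus.exists_classicalNS_smooth (d := d) hd.le hν.le hu₀ hdiv
  have hmean' : ∀ t ∈ Icc 0 T, Torus.HasZeroMean (v t) := fun t ht =>
    hsol.hasZeroMean_of_hasZeroMean (convex_Icc 0 T) (left_mem_Icc.2 hT.le) ht (hv0 ▸ hmean)
  have h0 : (0 : ℝ) ∈ Icc 0 T := left_mem_Icc.2 hT.le
  have hder := hrate hν hT hsol hv0 hmean'
  have hσ' : ∀ x, torusStretchingDensity (v 0) x ≤ 0 * torusVorticitySqAt (v 0) x := by
    intro x; rw [hv0, zero_mul]; exact hσ x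
  have hle := hB hd hν.le hT hsol 0 h0 0 le_rfl hσ' _ hder
  simpa using hle

/-! ## 3. The strain of a solution issued from the planar witness: planar initial slice and tangent -/

namespace PlanarShadow

open TrigPolyExact TrigPolyExact.TP PlanarTopEig

/-- Tables differentiated in `x₁` collect to `[]` (the witness is `x₁`-independent). [ours; by `decide`] -/
theorem collect_D1_tables :
    (∀ j : Fin 3, collect (TP.D 1 (W j)) = []) ∧ (∀ j : Fin 3, collect (TP.D 1 (TP.lapT (W j))) = []) ∧
      (∀ j : Fin 3, collect (TP.D 1 (TP.D j P)) = []) := by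
  refine ⟨?_, ?_, ?_⟩ <;> decide +kernel

/-- `(∂₁w)ⱼ = 0`. [ours] -/
theorem partialDeriv_one_w (x : UnitAddTorus (Fin 3)) (j : Fin 3) : Torus.partialDeriv 1 w x j = 0 := by
  rw [partialDeriv_w, ← evalR_collect, collect_D1_tables.1 j]; simp [evalR]

/-- `(∂ₖw)₁ = 0`. [ours] -/
theorem partialDeriv_w_one (k : Fin 3) (x : UnitAddTorus (Fin 3)) : Torus.partialDeriv k w x 1 = 0 := by
  rw [partialDeriv_w, W_one]; simp [TP.D, evalR]

/-- `∂₁∂ⱼπ_w = 0`. [ours] -/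
theorem hessian_one_pressureOf_w (j : Fin 3) (x : UnitAddTorus (Fin 3)) :
    Torus.partialDeriv 1 (Torus.partialDeriv j (pressureOf w)) x = 0 := by
  rw [hessian_pressureOf_w, ← evalR_collect, collect_D1_tables.2.2 j]; simp [evalR]

/-- The Laplacian of `w` in table form: `(Δw)ⱼ = (2π)² · evalR (lapT (W j))`. [ours] -/
theorem laplacian_w : Torus.laplacian w = ((2 * Real.pi) ^ 2) • tabField (fun j => TP.lapT (W j)) := by
  funext x
  rw [Pi.smul_apply, laplacian_eq_sum_partialDeriv_partialDeriv isSmooth_w, Fin.sum_univ_three]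
  ext j
  simp only [PiLp.add_apply, PiLp.smul_apply, smul_eq_mul, tabField_apply, partialDeriv_partialDeriv_w,
    TP.lapT, evalR_append]
  ring

/-- `(∂₁Δw)ⱼ = 0`. [ours] -/
theorem partialDeriv_one_laplacian_w (x : UnitAddTorus (Fin 3)) (j : Fin 3) :
    Torus.partialDeriv 1 (Torus.laplacian w) x j = 0 := by
  rw [laplacian_w, partialDeriv_const_smul ((isSmooth_tabField _).isContDiff (by simp)),
    Pi.smul_apply, partialDeriv_tabField]
  simp only [PiLp.smul_apply, smul_eq_mul, tabField_apply]
  rw [← evalR_collect, collect_D1_tables.2.1 j]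
  simp [evalR]

/-- `(∂ⱼΔw)₁ = 0`. [ours] -/
theorem partialDeriv_laplacian_w_one (j : Fin 3) (x : UnitAddTorus (Fin 3)) :
    Torus.partialDeriv j (Torus.laplacian w) x 1 = 0 := by
  rw [laplacian_w, partialDeriv_const_smul ((isSmooth_tabField _).isContDiff (by simp)),
    Pi.smul_apply, partialDeriv_tabField]
  simp [tabField_apply, TP.lapT, TP.D, evalR]

/-- The middle row of the strain of `w` vanishes identically. [ours] -/
theorem strainFlat_w_row (x : UnitAddTorus (Fin 3)) (j : Fin 3) : strainFlat w x (1, j) = 0 := by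
  rw [strainFlat_apply]; simp [partialDeriv_one_w, partialDeriv_w_one]

/-- **The strain of `w` is planar trace-free at every point.** [ours] -/
theorem isPlanarTF_strainFlat_w (x : UnitAddTorus (Fin 3)) : IsPlanarTF (strainFlat w x) where
  symm i j := strainFlat_symm w x i j
  row j := strainFlat_w_row x j
  tr := by
    have h := sum_diag_strainFlat_eq_zero isSmooth_w isDivFree_w x
    rw [Fin.sum_univ_three, strainFlat_w_row x 1] at h
    linarith

/-- **The initial strain tendency of every classical solution issued from `w` is planar trace-free.**
[ours] -/
theorem isPlanarTF_strainTendency {ν T : ℝ} (hT : 0 < T)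
    {u : ℝ → UnitAddTorus (Fin 3) → EuclideanSpace ℝ (Fin 3)} {p : ℝ → UnitAddTorus (Fin 3) → ℝ}
    (hsol : Torus.IsClassicalNSSolutionOn (Icc 0 T) ν 0 u p) (hu0 : u 0 = w)
    (y : UnitAddTorus (Fin 3)) :
    IsPlanarTF (Torus.timeDerivWithin (Icc 0 T) (fun s z => strainFlat (u s) z) 0 y) := by
  have hU : UniqueDiffOn ℝ (Icc 0 T) := uniqueDiffOn_Icc hT
  have h0 : (0 : ℝ) ∈ Icc 0 T := left_mem_Icc.2 hT.le
  have hΘ := isSmoothSpaceTimeOn_strainFlat hsol.smooth_velocity hU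
  -- coordinates of the tendency are derivatives of the (symmetric) entries
  have hcoord : ∀ i j, Torus.timeDerivWithin (Icc 0 T) (fun s z => strainFlat (u s) z) 0 y (i, j) =
      derivWithin (fun s => strainFlat (u s) y (i, j)) (Icc 0 T) 0 := by
    intro i j
    rw [← timeDerivWithin_apply_coord hΘ hU h0 y (i, j)]; rfl
  -- the middle row: strain transport at `t = 0`, every term has vanishing middle row
  have hrow : ∀ j, Torus.timeDerivWithin (Icc 0 T) (fun s z => strainFlat (u s) z) 0 y (1, j) = 0 := by
    intro j
    rw [timeDerivWithin_strainFlat_eq hsol hT h0 y, hu0]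
    have hp : ∀ j, Torus.partialDeriv 1 (Torus.partialDeriv j (p 0)) y = 0 := by
      intro j
      have e : Torus.partialDeriv j (p 0) = Torus.partialDeriv j (pressureOf w) := by
        rw [← hu0, pressureOf_eq_pressure_sub_integral hsol hT h0]
        funext z; exact (partialDeriv_fun_sub_const (p 0) _ j z).symm
      rw [e]; exact hessian_one_pressureOf_w j y
    have hzero : ∀ i, Torus.partialDeriv i ((0 : ℝ → UnitAddTorus (Fin 3) → EuclideanSpace ℝ (Fin 3)) 0) y = 0 := by
      intro i; simp [Torus.partialDeriv, Torus.lineDeriv]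
    have hrowfun : (fun z => strainFlat w z (1, j)) = fun _ => 0 := funext fun z => strainFlat_w_row z j
    have hdS : ∀ k, Torus.partialDeriv k (strainFlat w) y (1, j) = 0 := by
      intro k
      rw [← EuclideanCoord.partialDeriv_apply_coord ((isSmooth_strainFlat isSmooth_w).isContDiff (by simp)),
        hrowfun]
      simp [Torus.partialDeriv, Torus.lineDeriv]
    simp only [PiLp.sub_apply, PiLp.add_apply, PiLp.smul_apply, smul_eq_mul, WithLp.ofLp_sum,
      Finset.sum_apply, laplacian_strainFlat_apply isSmooth_w, pressVec_apply, strainFlat_apply,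
      nonlinVec_apply, partialDeriv_one_laplacian_w, partialDeriv_laplacian_w_one, hp, hzero,
      partialDeriv_one_w, partialDeriv_w_one, hdS]
    simp
  refine ⟨fun i j => ?_, hrow, ?_⟩
  · rw [hcoord, hcoord]
    congr 1; funext s; exact strainFlat_symm (u s) y i j
  · -- trace: `∑ᵢ Sᵢᵢ(u s) = 0` on `[0, T]`, differentiate
    have hsum : HasDerivWithinAt (fun s => ∑ i : Fin 3, strainFlat (u s) y (i, i))
        (∑ i : Fin 3, Torus.timeDerivWithin (Icc 0 T) (fun s z => strainFlat (u s) z) 0 y (i, i))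
        (Icc 0 T) 0 := by
      refine HasDerivWithinAt.fun_sum fun i _ => ?_
      rw [hcoord]
      exact ((EuclideanSpace.proj (i, i) : EuclideanSpace ℝ (Fin 3 × Fin 3) →L[ℝ] ℝ).hasFDerivAt.comp_hasDerivWithinAt
        0 (hΘ.hasDerivWithinAt_slice h0 y)).differentiableWithinAt.hasDerivWithinAt
    have hzero : HasDerivWithinAt (fun s => ∑ i : Fin 3, strainFlat (u s) y (i, i)) 0 (Icc 0 T) 0 := by
      refine (hasDerivWithinAt_const 0 (Icc 0 T) (0 : ℝ)).congr (fun s hs => ?_) ?_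
      · exact sum_diag_strainFlat_eq_zero (hsol.smooth_velocity.isSmooth_slice hs) (hsol.divFree s hs) y
      · exact sum_diag_strainFlat_eq_zero (hsol.smooth_velocity.isSmooth_slice h0) (hsol.divFree 0 h0) y
    have heq := (hU 0 h0).eq_deriv _ hsum hzero
    rw [Fin.sum_univ_three, hrow 1] at heq
    linarith

/-! ## 4. The initial derivative of the eigenvalue moments along solutions issued from `w` -/

/-- `∫(λ₁⁺)⁴ = ∫ λ(S)⁴` for smooth divergence-free fields (`λ₁ ≥ 0`). [ours; bookkeeping] -/
theorem topEigMoment_four_eq {v : UnitAddTorus (Fin 3) → EuclideanSpace ℝ (Fin 3)} (hv : Torus.IsSmooth v)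
    (hdiv : Torus.IsDivFree v) : torusTopEigMoment 4 v = ∫ x, lam (strainFlat v x) ^ 4 := by
  unfold torusTopEigMoment
  refine integral_congr_ae (ae_of_all _ fun x => ?_)
  dsimp only
  rw [← lam_strainFlat, max_eq_left (lam_strainFlat_nonneg hv hdiv x),
    show (4 : ℝ) = ((4 : ℕ) : ℝ) by norm_num, Real.rpow_natCast]

/-- `∫((−λ₃)⁺)⁴ = ∫ λ(−S)⁴` for smooth divergence-free fields. [ours; bookkeeping] -/
theorem negBotEigMoment_four_eq {v : UnitAddTorus (Fin 3) → EuclideanSpace ℝ (Fin 3)}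
    (hv : Torus.IsSmooth v) (hdiv : Torus.IsDivFree v) :
    torusNegBotEigMoment 4 v = ∫ x, lam (-strainFlat v x) ^ 4 := by
  unfold torusNegBotEigMoment
  refine integral_congr_ae (ae_of_all _ fun x => ?_)
  dsimp only
  rw [← lam_neg_strainFlat, max_eq_left (lam_neg_strainFlat_nonneg hv hdiv x),
    show (4 : ℝ) = ((4 : ℕ) : ℝ) by norm_num, Real.rpow_natCast]

/-- `¼∫|S|⁴ = ∫ (‖S‖²)²/4` (real power `(|S|²)^{4/2}` versus the flattened norm). [ours; bookkeeping] -/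
theorem strainMoment_four_eq (v : UnitAddTorus (Fin 3) → EuclideanSpace ℝ (Fin 3)) :
    (∫ x, (‖strainFlat v x‖ ^ 2) ^ 2 / 4) = 1 / 4 * torusStrainMoment 4 v := by
  rw [torusStrainMoment, ← integral_const_mul]
  refine integral_congr_ae (ae_of_all _ fun x => ?_)
  dsimp only
  rw [norm_strainFlat_sq, show ((4 : ℝ) / 2) = ((2 : ℕ) : ℝ) by norm_num, Real.rpow_natCast]
  ring

/-- **Initial derivative of `∫(λ₁⁺)⁴` and `∫((−λ₃)⁺)⁴` along EVERY classical solution issued from the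
planar witness**: both equal `¼(N₄(w) + νV₄(w))` (one-sided, within `[0, T]`). [ours] -/
theorem hasDerivWithinAt_eigMoments_four {ν T : ℝ} (hν : 0 < ν) (hT : 0 < T)
    {u : ℝ → UnitAddTorus (Fin 3) → EuclideanSpace ℝ (Fin 3)} {p : ℝ → UnitAddTorus (Fin 3) → ℝ}
    (hsol : Torus.IsClassicalNSSolutionOn (Icc 0 T) ν 0 u p) (hu0 : u 0 = w)
    (hmean : ∀ t ∈ Icc 0 T, Torus.HasZeroMean (u t)) :
    HasDerivWithinAt (fun s => torusTopEigMoment 4 (u s))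
        (strainMomentInertialRate 4 w / 4 + ν * (strainMomentViscousRate 4 w / 4)) (Icc 0 T) 0 ∧
      HasDerivWithinAt (fun s => torusNegBotEigMoment 4 (u s))
        (strainMomentInertialRate 4 w / 4 + ν * (strainMomentViscousRate 4 w / 4)) (Icc 0 T) 0 := by
  have hU : UniqueDiffOn ℝ (Icc 0 T) := uniqueDiffOn_Icc hT
  have h0 : (0 : ℝ) ∈ Icc 0 T := left_mem_Icc.2 hT.le
  have hΘ := isSmoothSpaceTimeOn_strainFlat hsol.smooth_velocity hU
  have hpl0 : ∀ x, IsPlanarTF ((fun s z => strainFlat (u s) z) 0 x) := fun x => by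
    simp only [hu0]; exact isPlanarTF_strainFlat_w x
  have hpl1 := isPlanarTF_strainTendency hT hsol hu0
  -- the `|S|⁴` balance at the initial time
  have hI := hasInitialRate_torusStrainMoment (d := Fin 3) (q := 4) (by norm_num) (Fintype.card_fin 3)
    hν hT hsol hmean
  rw [hu0] at hI
  have hD : HasDerivWithinAt (fun s => ∫ x, (‖(fun s z => strainFlat (u s) z) s x‖ ^ 2) ^ 2 / 4)
      (strainMomentInertialRate 4 w / 4 + ν * (strainMomentViscousRate 4 w / 4)) (Icc 0 T) 0 := by
    have e : (fun s => ∫ x, (‖(fun s z => strainFlat (u s) z) s x‖ ^ 2) ^ 2 / 4) =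
        fun s => 1 / 4 * torusStrainMoment 4 (u s) := funext fun s => strainMoment_four_eq (u s)
    rw [e]
    exact (hI.const_mul (1 / 4)).congr_deriv (by ring)
  have hs : ∀ s ∈ Icc 0 T, Torus.IsSmooth (u s) := fun s hs => hsol.smooth_velocity.isSmooth_slice hs
  constructor
  · refine (hasDerivWithinAt_integral_lam_pow_four hT hΘ hpl0 hpl1 hD).congr (fun s hs' => ?_) ?_
    · exact topEigMoment_four_eq (hs s hs') (hsol.divFree s hs')
    · exact topEigMoment_four_eq (hs 0 h0) (hsol.divFree 0 h0)
  · refine (hasDerivWithinAt_integral_lam_neg_pow_four hT hΘ hpl0 hpl1 hD).congr (fun s hs' => ?_) ?_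
    · exact negBotEigMoment_four_eq (hs s hs') (hsol.divFree s hs')
    · exact negBotEigMoment_four_eq (hs 0 h0) (hsol.divFree 0 h0)

/-- The common initial inertial rate `N₄(w)/4 = (1/10)(2π)⁵` is positive. [ours] -/
theorem quarter_strainMomentInertialRate_four_w_pos : 0 < strainMomentInertialRate 4 w / 4 := by
  have := strainMomentInertialRate_four_w_pos; positivity

/-! ## 5. The kills -/

/-- **`ES.lam1.q=4 | T_C | C3b` is FALSE for every `C`.** [ours] -/
theorem not_topEigMomentMidEigRateBound_four (C : ℝ) :
    ¬ TopEigMomentMidEigRateBound (d := Fin 3) 4 C := fun hB =>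
  absurd (FunctionalMidEigRateBound.initialRateAt_nonpos hB (Fintype.card_fin 3) isSmooth_w isDivFree_w
      hasZeroMean_w middle_w_nonpos
      (fun hν _ hT _ _ hsol hu0 hmean => (hasDerivWithinAt_eigMoments_four hν hT hsol hu0 hmean).1))
    (not_le.mpr quarter_strainMomentInertialRate_four_w_pos)

/-- **`ES.lam1.q=4 | T_C | C3a` is FALSE for every `C`.** [ours] -/
theorem not_topEigMomentStretchRateBound_four (C : ℝ) :
    ¬ TopEigMomentStretchRateBound (d := Fin 3) 4 C := fun hB =>
  absurd (FunctionalStretchRateBound.initialRateAt_nonpos hB (Fintype.card_fin 3) isSmooth_w isDivFree_w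
      hasZeroMean_w stretchingDensity_w_nonpos
      (fun hν _ hT _ _ hsol hu0 hmean => (hasDerivWithinAt_eigMoments_four hν hT hsol hu0 hmean).1))
    (not_le.mpr quarter_strainMomentInertialRate_four_w_pos)

/-- **`ES.neglam3.q=4 | T_C | C3b` is FALSE for every `C`.** [ours] -/
theorem not_negBotEigMomentMidEigRateBound_four (C : ℝ) :
    ¬ NegBotEigMomentMidEigRateBound (d := Fin 3) 4 C := fun hB =>
  absurd (FunctionalMidEigRateBound.initialRateAt_nonpos hB (Fintype.card_fin 3) isSmooth_w isDivFree_w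
      hasZeroMean_w middle_w_nonpos
      (fun hν _ hT _ _ hsol hu0 hmean => (hasDerivWithinAt_eigMoments_four hν hT hsol hu0 hmean).2))
    (not_le.mpr quarter_strainMomentInertialRate_four_w_pos)

/-- **`ES.neglam3.q=4 | T_C | C3a` is FALSE for every `C`.** [ours] -/
theorem not_negBotEigMomentStretchRateBound_four (C : ℝ) :
    ¬ NegBotEigMomentStretchRateBound (d := Fin 3) 4 C := fun hB =>
  absurd (FunctionalStretchRateBound.initialRateAt_nonpos hB (Fintype.card_fin 3) isSmooth_w isDivFree_w
      hasZeroMean_w stretchingDensity_w_nonpos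
      (fun hν _ hT _ _ hsol hu0 hmean => (hasDerivWithinAt_eigMoments_four hν hT hsol hu0 hmean).2))
    (not_le.mpr quarter_strainMomentInertialRate_four_w_pos)

/-- Summary in the generic shapes: no constant makes any of the four eigenvalue-core rows true on
`(ℝ/ℤ)³`. [ours] -/
theorem planarShadow_eig_killAll (C : ℝ) :
    ¬ FunctionalMidEigRateBound (d := Fin 3) (torusTopEigMoment 4) C ∧
    ¬ FunctionalStretchRateBound (d := Fin 3) (torusTopEigMoment 4) C ∧
    ¬ FunctionalMidEigRateBound (d := Fin 3) (torusNegBotEigMoment 4) C ∧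
    ¬ FunctionalStretchRateBound (d := Fin 3) (torusNegBotEigMoment 4) C :=
  ⟨not_topEigMomentMidEigRateBound_four C, not_topEigMomentStretchRateBound_four C,
    not_negBotEigMomentMidEigRateBound_four C, not_negBotEigMomentStretchRateBound_four C⟩

end PlanarShadow

end Summit.NavierStokesRegularity.FunctionalMining

end
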